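import Mathlib.RingTheory.Localization.Module
import Mathlib.FieldTheory.IntermediateField.Adjoin.Algebra
import Mathlib.FieldTheory.IntermediateField.Adjoin.Basic
import Mathlib.RingTheory.Valuation.Integral
import Mathlib.RingTheory.AlgebraicIndependent.TranscendenceBasis
import Mathlib.RingTheory.Polynomial.Tower
import Mathlib.Algebra.Polynomial.Inductions
import Mathlib.LinearAlgebra.Dimension.Free
import Literature.NumberTheory.DiophantineGeometry.FunctionFieldGenus
import HarnessLib

/-!
# Algebraic function fields of one variable — discharged facts

Proofs of named facts stated in `Literature.NumberTheory.DiophantineGeometry.FunctionFieldGenus`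
(kept in a sibling file so that the statement file stays a definitions/named-facts file and does
not acquire the heavier imports used here).

* `AlgFunctionField.PlaceOver.finiteDimensional_residueField_holds` discharges
  `AlgFunctionField.PlaceOver.finiteDimensional_residueField` (Stichtenoth, *Algebraic Function
  Fields and Codes*, 2nd ed. 2009, Prop. 1.1.15, pp. 6–7: if `P` is a place of `F/K` and
  `0 ≠ x ∈ P` then `deg P ≤ [F : K(x)] < ∞`).

## Proof architecture (Stichtenoth, proof of Prop. 1.1.15, with Remark 1.1.2 and Prop. 1.1.5)

Let `v` be a place with valuation ring `O = O_v ⊋ K`, maximal ideal `P` and residue field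
`F_v = O/P`.

1. `O ≠ F`, so some `y ∉ O`; then `x := y⁻¹ ∈ P`, `x ≠ 0`.
2. `x` is transcendental over `K` (Prop. 1.1.5 (c): an element algebraic over `K` is integral
   over `K ⊆ O`, valuation rings are integrally closed — Mathlib
   `Valuation.Integers.isIntegral_iff_v_le_one` — so `y = x⁻¹` would lie in `O`).
3. `[F : K(x)] < ∞` (Remark 1.1.2, here `IsAlgFunctionField.finiteDimensional_adjoin_simple`):
   `{x}` is algebraically independent of cardinality `1 = trdeg_K F`, hence a transcendence basis
   (Mathlib `AlgebraicIndependent.isTranscendenceBasis_of_trdeg_le_of_finite`), so `F/K(x)` is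
   algebraic (`IsTranscendenceBasis.isAlgebraic_field`); `F = K(S)` with `S` finite gives
   `F = K(x)(S)` finite over `K(x)` (`IntermediateField.finiteDimensional_adjoin`).
4. Key step (`linearIndependent_adjoin_of_linearIndependent_residue`): if `z₁, …, zₙ ∈ O` have
   residues linearly independent over `K`, then `z₁, …, zₙ` are linearly independent over `K(x)`.
   By `LinearIndependent.iff_fractionRing` it suffices to treat coefficients in `K[x]`
   (`K(x) = Frac K[x]`, Mathlib's scoped instance `IntermediateField.algebraAdjoinAdjoin`). Given
   `∑ φᵢ(x) zᵢ = 0` with `φᵢ ∈ K[X]`, reducing modulo `P` (where `x ≡ 0`) gives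
   `∑ φᵢ(0) z̄ᵢ = 0`, so all constant terms vanish (`coeff_zero_eq_zero_of_sum_eq_zero`); then
   `φᵢ = X · ψᵢ`, cancelling `x ≠ 0` gives a relation of the same shape for the `ψᵢ`, and by
   induction every coefficient of every `φᵢ` vanishes (`coeff_eq_zero_of_sum_eq_zero`; this
   replaces Stichtenoth's "w.l.o.g. not all `φᵢ` are divisible by `x`").
5. Hence every finite `K`-linearly independent family in `F_v` (lifted to `O` along the surjection
   `O → F_v`) has at most `[F : K(x)]` elements, so `dim_K F_v ≤ [F : K(x)] < ∞` (`rank_le`,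
   `Module.rank_lt_aleph0_iff`).

## References

* H. Stichtenoth, *Algebraic Function Fields and Codes*, GTM 254, Springer 2009, §1.1:
  Remark 1.1.2, Prop. 1.1.5, Def. 1.1.14, Prop. 1.1.15 (pp. 1–7).
-/

noncomputable section

namespace Literature.NumberTheory.DiophantineGeometry

universe u v

section ResidueFieldProofs

variable {K : Type u} {F : Type v} [Field K] [Field F] [Algebra K F]

/-- **Stichtenoth Remark 1.1.2** (direction "⇒"): in an algebraic function field of one variable
`F/K`, if `z ∈ F` is transcendental over `K` then `F/K(z)` is a finite extension. Proof: `{z}` is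
an algebraically independent family of cardinality `1 = trdeg_K F`, hence a transcendence basis,
so `F/K(z)` is algebraic; and `F = K(S)` for a finite `S`, so `F = K(z)(S)` is finitely generated
by algebraic elements over `K(z)`. [cite: Stichtenoth2009, Remark 1.1.2] -/
theorem IsAlgFunctionField.finiteDimensional_adjoin_simple [IsAlgFunctionField K F] {z : F}
    (hz : Transcendental K z) : FiniteDimensional (IntermediateField.adjoin K {z}) F := by
  have hind : AlgebraicIndependent K ((↑) : ({z} : Set F) → F) :=
    algebraicIndependent_unique_type_iff.2 hz
  have hbasis : IsTranscendenceBasis K ((↑) : ({z} : Set F) → F) :=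
    hind.isTranscendenceBasis_of_trdeg_le_of_finite (by
      rw [IsAlgFunctionField.trdeg_eq_one (K := K) (F := F), Cardinal.mk_singleton])
  have halg : Algebra.IsAlgebraic (IntermediateField.adjoin K ({z} : Set F)) F := by
    have := hbasis.isAlgebraic_field
    rwa [Subtype.range_coe] at this
  obtain ⟨S, hS⟩ := IsAlgFunctionField.fg_top (K := K) (F := F)
  have htop : IntermediateField.adjoin (IntermediateField.adjoin K ({z} : Set F)) (S : Set F)
      = ⊤ := by
    apply IntermediateField.restrictScalars_injective K
    rw [IntermediateField.restrictScalars_top, IntermediateField.restrictScalars_adjoin,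
      eq_top_iff, ← hS]
    exact IntermediateField.adjoin.mono _ _ _ Set.subset_union_right
  have hfin : FiniteDimensional (IntermediateField.adjoin K ({z} : Set F))
      (IntermediateField.adjoin (IntermediateField.adjoin K ({z} : Set F)) (S : Set F)) :=
    IntermediateField.finiteDimensional_adjoin fun y _ ↦ (halg.isAlgebraic y).isIntegral
  rw [htop] at hfin
  exact LinearEquiv.finiteDimensional
    (IntermediateField.topEquiv (F := IntermediateField.adjoin K ({z} : Set F))
      (E := F)).toLinearEquiv

namespace AlgFunctionField.PlaceOver

open Polynomial

variable (v : PlaceOver K F)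

/-- Reduction step in the proof of Stichtenoth Prop. 1.1.15: let `x ∈ O_v` lie in the maximal
ideal (`x̄ = 0` in `F_v`) and let `r₁, …, rₙ ∈ O_v` have `K`-linearly independent residues. If
`∑ φᵢ(x) rᵢ = 0` with `φᵢ ∈ K[X]`, then every constant term `φᵢ(0)` vanishes: reducing modulo the
maximal ideal gives `∑ φᵢ(0) r̄ᵢ = 0` in `F_v`. [cite: Stichtenoth2009, proof of Prop. 1.1.15] -/
theorem coeff_zero_eq_zero_of_sum_eq_zero {x : v.toValuationSubring}
    (hx : IsLocalRing.residue _ x = 0) {ι : Type*} [Fintype ι] {r : ι → v.toValuationSubring}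
    (hr : LinearIndependent K fun i ↦ IsLocalRing.residue _ (r i)) {p : ι → K[X]}
    (hp : ∑ i, aeval x (p i) * r i = 0) (i : ι) : (p i).coeff 0 = 0 := by
  have key : ∀ j, IsLocalRing.residue _ (aeval x (p j)) =
      algebraMap K v.residueField ((p j).coeff 0) := by
    intro j
    rw [← IsLocalRing.ResidueField.algebraMap_eq, ← aeval_algebraMap_apply,
      IsLocalRing.ResidueField.algebraMap_eq, hx, coeff_zero_eq_aeval_zero']
  have h := congrArg (IsLocalRing.residue v.toValuationSubring) hp
  simp only [map_sum, map_mul, map_zero, key, ← Algebra.smul_def] at h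
  exact Fintype.linearIndependent_iff.1 hr _ h i

/-- Induction form of the key step of Stichtenoth Prop. 1.1.15: with `x ≠ 0` in the maximal ideal
of `O_v` and `r₁, …, rₙ ∈ O_v` with `K`-linearly independent residues, a relation
`∑ φᵢ(x) rᵢ = 0` (`φᵢ ∈ K[X]`) forces every coefficient of every `φᵢ` to vanish: the constant
terms vanish by `coeff_zero_eq_zero_of_sum_eq_zero`, so `φᵢ = X · ψᵢ` (`Polynomial.divX`), and
cancelling `x` yields a relation of the same shape for the `ψᵢ` (this replaces the printed
"w.l.o.g. not all `φᵢ(x)` are divisible by `x`"). [cite: Stichtenoth2009, proof of Prop. 1.1.15] -/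
theorem coeff_eq_zero_of_sum_eq_zero {x : v.toValuationSubring}
    (hx : IsLocalRing.residue _ x = 0) (hx0 : x ≠ 0) {ι : Type*} [Fintype ι]
    {r : ι → v.toValuationSubring}
    (hr : LinearIndependent K fun i ↦ IsLocalRing.residue _ (r i)) (n : ℕ) :
    ∀ {p : ι → K[X]}, ∑ i, aeval x (p i) * r i = 0 → ∀ i, (p i).coeff n = 0 := by
  induction n with
  | zero => exact fun hp ↦ v.coeff_zero_eq_zero_of_sum_eq_zero hx hr hp
  | succ n ih =>
    intro p hp i
    have h0 := v.coeff_zero_eq_zero_of_sum_eq_zero hx hr hp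
    have hp' : ∑ i, aeval x (divX (p i)) * r i = 0 := by
      have : ∑ i, aeval x (p i) * r i = x * ∑ i, aeval x (divX (p i)) * r i := by
        rw [Finset.mul_sum]
        refine Finset.sum_congr rfl fun j _ ↦ ?_
        conv_lhs => rw [← divX_mul_X_add (p j), h0 j, map_zero, add_zero, map_mul, aeval_X]
        ring
      rw [this] at hp
      exact (mul_eq_zero.1 hp).resolve_left hx0
    rw [← coeff_divX]
    exact ih hp' i

/-- Polynomial form of the key step of Stichtenoth Prop. 1.1.15: with `x ≠ 0` in the maximal
ideal of `O_v` and `r₁, …, rₙ ∈ O_v` with `K`-linearly independent residues, `∑ φᵢ(x) rᵢ = 0`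
with `φᵢ ∈ K[X]` forces `φᵢ = 0` for all `i`, i.e. the `rᵢ` are linearly independent over
`K[x]`. [cite: Stichtenoth2009, proof of Prop. 1.1.15] -/
theorem eq_zero_of_sum_eq_zero {x : v.toValuationSubring}
    (hx : IsLocalRing.residue _ x = 0) (hx0 : x ≠ 0) {ι : Type*} [Fintype ι]
    {r : ι → v.toValuationSubring}
    (hr : LinearIndependent K fun i ↦ IsLocalRing.residue _ (r i)) {p : ι → K[X]}
    (hp : ∑ i, aeval x (p i) * r i = 0) (i : ι) : p i = 0 :=
  Polynomial.ext fun n ↦ by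
    simpa using v.coeff_eq_zero_of_sum_eq_zero hx hx0 hr n hp i

open scoped IntermediateField.algebraAdjoinAdjoin in
/-- **Key step of Stichtenoth Prop. 1.1.15**: if `0 ≠ x ∈ P` (the maximal ideal of `O_v`) and
`z₁, …, zₙ ∈ O_v` have residue classes `z₁(P), …, zₙ(P) ∈ F_v` linearly independent over `K`,
then `z₁, …, zₙ` are linearly independent over `K(x)`. Reduced to coefficients in `K[x]` by
`LinearIndependent.iff_fractionRing` (`K(x) = Frac K[x]`, Mathlib's scoped instances
`IntermediateField.algebraAdjoinAdjoin`) and then to `eq_zero_of_sum_eq_zero`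
(`K[x] = image of K[X]` under `aeval x`, `Algebra.adjoin_singleton_eq_range_aeval`).
[cite: Stichtenoth2009, proof of Prop. 1.1.15] -/
theorem linearIndependent_adjoin_of_linearIndependent_residue {x : v.toValuationSubring}
    (hx : IsLocalRing.residue _ x = 0) (hx0 : x ≠ 0) {ι : Type*} [Fintype ι]
    {r : ι → v.toValuationSubring}
    (hr : LinearIndependent K fun i ↦ IsLocalRing.residue _ (r i)) :
    LinearIndependent (IntermediateField.adjoin K {(x : F)}) fun i ↦ (r i : F) := by
  rw [← LinearIndependent.iff_fractionRing (Algebra.adjoin K {(x : F)})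
    (IntermediateField.adjoin K {(x : F)}), Fintype.linearIndependent_iff]
  intro g hg
  have hmem : ∀ i, (g i : F) ∈ (aeval (x : F)).range := fun i ↦ by
    rw [← Algebra.adjoin_singleton_eq_range_aeval]; exact (g i).2
  choose p hp using fun i ↦ (AlgHom.mem_range _).1 (hmem i)
  have hco : ∀ i, ((aeval x (p i) : v.toValuationSubring) : F) = aeval (x : F) (p i) :=
    fun i ↦ (aeval_algebraMap_apply (B := F) x (p i)).symm
  have hsum : ∑ i, aeval x (p i) * r i = 0 := by
    apply Subtype.val_injective
    simp only [AddSubmonoidClass.coe_finsetSum, MulMemClass.coe_mul, ZeroMemClass.coe_zero, hco,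
      hp]
    simpa only [Subalgebra.smul_def, smul_eq_mul] using hg
  intro i
  apply Subtype.ext
  rw [← hp i, v.eq_zero_of_sum_eq_zero hx hx0 hr hsum i, map_zero]
  rfl

/-- Discharge of `AlgFunctionField.PlaceOver.finiteDimensional_residueField`
(**Stichtenoth Prop. 1.1.15**: the residue field `F_v` of a place of an algebraic function field
of one variable `F/K` is finite over `K`, indeed `deg v ≤ [F : K(x)] < ∞` for any `0 ≠ x ∈ P`).
Proof as printed: pick `y ∉ O_v` (`O_v ≠ F`), so `x = y⁻¹ ∈ P`, `x ≠ 0`; `x` is transcendental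
over `K` (Prop. 1.1.5 (c): otherwise `y = x⁻¹` is integral over `K ⊆ O_v` and valuation rings are
integrally closed, `Valuation.Integers.isIntegral_iff_v_le_one`); `[F : K(x)] < ∞`
(Remark 1.1.2, `IsAlgFunctionField.finiteDimensional_adjoin_simple`); every finite `K`-linearly
independent family of `F_v`, lifted to `O_v`, is `K(x)`-linearly independent in `F`
(`linearIndependent_adjoin_of_linearIndependent_residue`), hence has at most `[F : K(x)]`
members, so `dim_K F_v ≤ [F : K(x)]` (`rank_le`) and `F_v` is finite-dimensional
(`Module.rank_lt_aleph0_iff`). [cite: Stichtenoth2009, Prop. 1.1.15] -/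
theorem finiteDimensional_residueField_holds :
    @PlaceOver.finiteDimensional_residueField K F _ _ _ := by
  intro _ v
  obtain ⟨y, hy⟩ : ∃ y : F, y ∉ v.toValuationSubring := by
    by_contra! h
    exact v.ne_top (eq_top_iff.2 fun y _ ↦ h y)
  have hy0 : y ≠ 0 := by
    rintro rfl
    exact hy v.toValuationSubring.zero_mem
  have hy1 : 1 < v.toValuationSubring.valuation y := by
    rw [← not_le, v.toValuationSubring.valuation_le_one_iff]; exact hy
  obtain ⟨x, hxF⟩ : ∃ x : v.toValuationSubring, (x : F) = y⁻¹ :=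
    ⟨⟨y⁻¹, (v.toValuationSubring.mem_or_inv_mem y).resolve_left hy⟩, rfl⟩
  have hx0 : x ≠ 0 := by
    intro h
    have : (x : F) = 0 := congrArg Subtype.val h
    rw [hxF, inv_eq_zero] at this
    exact hy0 this
  have hxm : IsLocalRing.residue v.toValuationSubring x = 0 := by
    rw [IsLocalRing.residue_eq_zero_iff, v.toValuationSubring.valuation_lt_one_iff, hxF]
    exact (v.toValuationSubring.valuation.one_lt_val_iff hy0).1 hy1
  have hxt : Transcendental K (x : F) := by
    intro halg
    have h1 := halg.isIntegral.inv
    rw [hxF, inv_inv] at h1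
    have hint : IsIntegral v.toValuationSubring y := h1.tower_top
    have hInt : v.toValuationSubring.valuation.Integers v.toValuationSubring :=
      ⟨Subtype.val_injective, v.toValuationSubring.valuation_le_one,
        fun r hr ↦ ⟨⟨r, (v.toValuationSubring.valuation_le_one_iff r).1 hr⟩, rfl⟩⟩
    exact hy (v.toValuationSubring.mem_of_valuation_le_one _
      (hInt.isIntegral_iff_v_le_one.1 hint))
  haveI := IsAlgFunctionField.finiteDimensional_adjoin_simple hxt
  have hrank : Module.rank K v.residueField ≤
      (Module.finrank (IntermediateField.adjoin K {(x : F)}) F : ℕ) := by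
    apply rank_le
    intro s hs
    choose r hr using fun a : s ↦
      IsLocalRing.residue_surjective (R := v.toValuationSubring) (a : v.residueField)
    have hli : LinearIndependent K fun a : s ↦ IsLocalRing.residue v.toValuationSubring (r a) := by
      have : (fun a : s ↦ IsLocalRing.residue v.toValuationSubring (r a)) =
          fun a : s ↦ (a : v.residueField) := funext hr
      rw [this]
      exact hs
    have := (v.linearIndependent_adjoin_of_linearIndependent_residue hxm hx0 hli)
      |>.fintype_card_le_finrank
    simpa using this
  exact Module.rank_lt_aleph0_iff.1 (hrank.trans_lt (Cardinal.natCast_lt_aleph0 (n := _)))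

end AlgFunctionField.PlaceOver

end ResidueFieldProofs

end Literature.NumberTheory.DiophantineGeometry
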